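import Summits.Ventures.PercRepro.Night2LocalD2R14Pairs
import Summits.Ventures.PercRepro.Night2LocalD2R14Basis

/-!
# PercRepro — the large shadow sets of the coloop cell: the DEGREE of a point in the pair preimages (night-2, gen 16)

The columns of the rule R1₄ (Night2LocalD2R14Defs) at a shadow set `S` with `|S| ≥ 7` carry no keep and no spread
(`r14KeepPre_eq_empty`, `r14Spread_eq_zero`): they are the identity part, the covering part and the pair part.  This
file starts the COUNTING of the pair preimages at such `S` (paper: proofs/NIGHT-2-k1.md §6):

* in the coloop cell every member with `|G ∖ cl B| ≥ 2` contains the coloop `y` (`mem_of_two_le_card_sdiff_clF`), so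
  every pair preimage and every far preimage does; the identity preimage is unique (`card_r14IdPre_le_one`);
* two distinct pair preimages have `ρ(cl B₁ ∩ cl B₂) ≤ 3` (`rkN_inter_clF_le_three_of_pairPre`);
* **`card_pairPre_filter_mem_le_two`** (THE DEGREE BOUND): in a simple matroid, a point `b ∈ S` lies in the pair set
  `S ∖ B` of at most two pair preimages `B` once `|S| ≥ 7` — three pair sets `{b, wᵢ}` would put
  `R = S ∖ {b, w₁, w₂, w₃}` (rank `3`: it holds `y` and two further points) inside `cl B₁ ∩ cl B₂` and `cl B₁ ∩ cl B₃`
  (rank `≤ 3`, hence both `= cl R`), so `w₂, w₃ ∈ cl R` and `B₁ = S ∖ {b, w₁} ⊆ cl R` would have rank `≤ 3`.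
-/

namespace PercRepro.Shadow

open Finset PerFlat ThmH

variable {α : Type*} [DecidableEq α] {M : Matroid α} [M.Finite]

/-! ## Simplicity -/

/-- In a simple matroid a set of rank `≤ 1` has at most one element. -/
theorem card_le_one_of_rkN_le_one (hsimple : ∀ e ∈ gr M, ∀ f ∈ gr M, e ≠ f → rkN M {e, f} = 2)
    {X : Finset α} (hX : X ⊆ gr M) (hr : rkN M X ≤ 1) : X.card ≤ 1 := by
  rw [Finset.card_le_one]
  intro e he f hf
  by_contra hne
  have h := hsimple e (hX he) f (hX hf) hne
  have hsub : ({e, f} : Finset α) ⊆ X := by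
    intro x hx
    simp only [Finset.mem_insert, Finset.mem_singleton] at hx
    rcases hx with rfl | rfl <;> assumption
  have := rkN_mono (M := M) hsub
  omega

/-- In a simple matroid a set with two elements has rank `≥ 2`. -/
theorem two_le_rkN_of_two_le_card (hsimple : ∀ e ∈ gr M, ∀ f ∈ gr M, e ≠ f → rkN M {e, f} = 2)
    {X : Finset α} (hX : X ⊆ gr M) (hc : 2 ≤ X.card) : 2 ≤ rkN M X := by
  by_contra h
  push Not at h
  have := card_le_one_of_rkN_le_one hsimple hX (by omega)
  omega

/-! ## The coloop lies in every member with `m ≥ 2` -/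

open scoped Classical in
/-- A member with `|G ∖ cl B| ≥ 2` contains the coloop `y` of `M|G`. -/
theorem mem_of_two_le_card_sdiff_clF {G : Finset α} (hG : G ∈ flatsQ M (4 + 1)) {y : α} (hyG : y ∈ G)
    (hyc : y ∉ clF M (G.erase y)) {B : Finset α} (hB : B ∈ membersIn M (Uq M (4 + 2) 4) G)
    (hm : 2 ≤ (G \ clF M B).card) : y ∈ B := by
  by_contra hyB
  have hBU : B ∈ Uq M (4 + 2) 4 := (mem_membersIn.1 hB).1
  have hBG : B ⊆ G := (subset_clF hBU).trans (mem_membersIn.1 hB).2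
  have hBy : B ⊆ G.erase y := by
    intro e he
    rw [Finset.mem_erase]
    exact ⟨fun h => hyB (h ▸ he), hBG he⟩
  have h1 := sdiff_clF_eq_singleton_of_subset_erase hG hyG hyc hB hBy
  rw [h1, Finset.card_singleton] at hm
  omega

open scoped Classical in
/-- Every pair preimage contains the coloop `y`. -/
theorem mem_of_mem_pairPre {G : Finset α} (hG : G ∈ flatsQ M (4 + 1)) {y : α} (hyG : y ∈ G)
    (hyc : y ∉ clF M (G.erase y)) {S B : Finset α} (hB : B ∈ pairPre M 4 G S) : y ∈ B :=
  mem_of_two_le_card_sdiff_clF hG hyG hyc (mem_pairPre.1 hB).1 (two_le_card_sdiff_clF_of_mem_pairPre hB)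

open scoped Classical in
/-- The pair set `S ∖ B` of a pair preimage lies in `G ∖ cl B`. -/
theorem sdiff_subset_of_mem_pairPre {q : ℕ} {G S B : Finset α} (hB : B ∈ pairPre M q G S) :
    S \ B ⊆ G \ clF M B := by
  obtain ⟨-, P, hP, rfl⟩ := mem_pairPre.1 hB
  rw [Finset.mem_powersetCard] at hP
  intro e he
  rw [Finset.mem_sdiff, Finset.mem_union] at he
  rcases he.1 with h | h
  · exact absurd h he.2
  · exact hP.1 h

open scoped Classical in
/-- A pair preimage is recovered from its pair set: `B = S ∖ (S ∖ B)`. -/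
theorem eq_sdiff_sdiff_of_mem_pairPre {q : ℕ} {G S B : Finset α} (hB : B ∈ pairPre M q G S) :
    B = S \ (S \ B) :=
  (Finset.sdiff_sdiff_eq_self (subset_of_mem_pairPre hB)).symm

open scoped Classical in
/-- Distinct pair preimages have distinct pair sets. -/
theorem sdiff_ne_of_mem_pairPre {q : ℕ} {G S B₁ B₂ : Finset α} (h₁ : B₁ ∈ pairPre M q G S)
    (h₂ : B₂ ∈ pairPre M q G S) (hne : B₁ ≠ B₂) : S \ B₁ ≠ S \ B₂ := by
  intro h
  apply hne
  rw [eq_sdiff_sdiff_of_mem_pairPre h₁, eq_sdiff_sdiff_of_mem_pairPre h₂, h]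

open scoped Classical in
/-- The identity preimage of a shadow set is unique: it is `S ∖ {y}`. -/
theorem card_r14IdPre_le_one {G : Finset α} (hG : G ∈ flatsQ M (4 + 1)) {y : α} (hyG : y ∈ G)
    (hyc : y ∉ clF M (G.erase y)) (hP : ∀ z ∈ G.erase y, 4 ≤ rkN M ((G.erase y).erase z)) {S : Finset α}
    (hS : S ∈ shadowAt M (4 + 2) 4 (Uq M (4 + 2) 4) G) : (r14IdPre M G S).card ≤ 1 := by
  have hyS : y ∈ S := mem_of_mem_shadowAt_of_coloop (by rw [rkN_erase_eq_of_coloop hG hyG hyc]) hS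
  rw [Finset.card_le_one]
  intro B hB B' hB'
  unfold r14IdPre at hB hB'
  rw [Finset.mem_filter] at hB hB'
  rw [eq_erase_coloop_of_coverPreimage_card_one hG hyG hyc hP hB.1 hB.2.1 hyS,
    eq_erase_coloop_of_coverPreimage_card_one hG hyG hyc hP hB'.1 hB'.2.1 hyS]

/-! ## Two pair preimages -/

open scoped Classical in
/-- Two distinct pair preimages of `S` have `ρ(cl B₁ ∩ cl B₂) ≤ 3`. -/
theorem rkN_inter_clF_le_three_of_pairPre {G : Finset α} (hG : G ∈ flatsQ M (4 + 1)) {S B₁ B₂ : Finset α}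
    (h₁ : B₁ ∈ pairPre M 4 G S) (h₂ : B₂ ∈ pairPre M 4 G S) (hne : B₁ ≠ B₂) :
    rkN M (clF M B₁ ∩ clF M B₂) ≤ 3 := by
  have hB₁ := (mem_pairPre.1 h₁).1
  have hB₂ := (mem_pairPre.1 h₂).1
  have hU₁ : B₁ ∈ Uq M (4 + 2) 4 := (mem_membersIn.1 hB₁).1
  have hU₂ : B₂ ∈ Uq M (4 + 2) 4 := (mem_membersIn.1 hB₂).1
  have hXne := sdiff_ne_of_mem_pairPre h₁ h₂ hne
  obtain ⟨z, hz₁, hz₂⟩ : ∃ z ∈ S \ B₁, z ∉ S \ B₂ := by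
    by_contra hcon
    push Not at hcon
    apply hXne
    apply Finset.eq_of_subset_of_card_le hcon
    rw [card_sdiff_of_mem_pairPre h₁, card_sdiff_of_mem_pairPre h₂]
  have hzG : z ∈ G \ clF M B₁ := sdiff_subset_of_mem_pairPre h₁ hz₁
  have hzB₂ : z ∈ B₂ := by
    by_contra h
    exact hz₂ (Finset.mem_sdiff.2 ⟨(Finset.mem_sdiff.1 hz₁).1, h⟩)
  have hrU : 5 ≤ rkN M (clF M B₁ ∪ clF M B₂) := by
    have h1 : insert z B₁ ⊆ clF M B₁ ∪ clF M B₂ :=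
      Finset.insert_subset (Finset.mem_union_right _ (subset_clF hU₂ hzB₂))
        ((subset_clF hU₁).trans Finset.subset_union_left)
    have h2 := rkN_insert_eq_of_mem_sdiff_clF hG hU₁ hzG
    have := rkN_mono (M := M) h1
    omega
  have hsub := rkN_submod (M := M) (clF M B₁) (clF M B₂)
  rw [rkN_clF_eq_of_mem_Uq hU₁, rkN_clF_eq_of_mem_Uq hU₂] at hsub
  omega

/-! ## The degree bound -/

open scoped Classical in
/-- A subset of `S ∖ {y}` with two elements together with `y` has rank `≥ 3` (simple matroid, `y` a coloop of `M|G`). -/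
theorem three_le_rkN_insert_of_two_le_card {G : Finset α} (hGg : G ⊆ gr M) {y : α} (hyG : y ∈ G)
    (hyc : y ∉ clF M (G.erase y)) (hsimple : ∀ e ∈ gr M, ∀ f ∈ gr M, e ≠ f → rkN M {e, f} = 2)
    {R : Finset α} (hR : R ⊆ G.erase y) (hc : 2 ≤ R.card) : 3 ≤ rkN M (insert y R) := by
  have hRg : R ⊆ gr M := (hR.trans (Finset.erase_subset _ _)).trans hGg
  have hyR : y ∉ clF M R := fun h => hyc (clF_mono hR h)
  rw [rkN_insert_eq_add_one_of_notMem_clF hRg (hGg hyG) hyR]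
  have := two_le_rkN_of_two_le_card hsimple hRg hc
  omega

set_option maxHeartbeats 400000 in
open scoped Classical in
/-- **THE DEGREE BOUND**: at a shadow set `S` with `|S| ≥ 7` of the coloop cell (simple matroid), a point `b` lies in
the pair set `S ∖ B` of at most two pair preimages `B`. -/
theorem card_pairPre_filter_mem_le_two {G : Finset α} (hG : G ∈ flatsQ M (4 + 1))
    (hsimple : ∀ e ∈ gr M, ∀ f ∈ gr M, e ≠ f → rkN M {e, f} = 2) {y : α} (hyG : y ∈ G)
    (hyc : y ∉ clF M (G.erase y)) {S : Finset α} (hS : S ∈ shadowAt M (4 + 2) 4 (Uq M (4 + 2) 4) G)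
    (h7 : 7 ≤ S.card) (b : α) : ((pairPre M 4 G S).filter (fun B => b ∈ S \ B)).card ≤ 2 := by
  have hGg : G ⊆ gr M := (mem_flatsQ.1 hG).1
  have hSG : S ⊆ G := subset_of_mem_shadowAt hS
  by_contra hcon
  push Not at hcon
  rw [Finset.two_lt_card_iff] at hcon
  obtain ⟨B₁, B₂, B₃, hB₁, hB₂, hB₃, h₁₂, h₁₃, h₂₃⟩ := hcon
  rw [Finset.mem_filter] at hB₁ hB₂ hB₃
  obtain ⟨hp₁, hb₁⟩ := hB₁
  obtain ⟨hp₂, hb₂⟩ := hB₂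
  obtain ⟨hp₃, hb₃⟩ := hB₃
  have hy₁ := mem_of_mem_pairPre hG hyG hyc hp₁
  have hy₂ := mem_of_mem_pairPre hG hyG hyc hp₂
  have hy₃ := mem_of_mem_pairPre hG hyG hyc hp₃
  have hU₁ : B₁ ∈ Uq M (4 + 2) 4 := (mem_membersIn.1 (mem_pairPre.1 hp₁).1).1
  -- the pair sets are `{b, wᵢ}`
  have hpair : ∀ B ∈ pairPre M 4 G S, b ∈ S \ B → ∃ w, w ≠ b ∧ S \ B = {b, w} := by
    intro B hB hbB
    have hc := card_sdiff_of_mem_pairPre hB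
    rw [Finset.card_eq_two] at hc
    obtain ⟨x, w, hxw, hxy⟩ := hc
    rw [hxy, Finset.mem_insert, Finset.mem_singleton] at hbB
    rcases hbB with rfl | rfl
    · exact ⟨w, fun h => hxw h.symm, hxy⟩
    · refine ⟨x, hxw, ?_⟩
      rw [hxy, Finset.pair_comm]
  obtain ⟨w₁, hw₁b, hX₁⟩ := hpair B₁ hp₁ hb₁
  obtain ⟨w₂, hw₂b, hX₂⟩ := hpair B₂ hp₂ hb₂
  obtain ⟨w₃, hw₃b, hX₃⟩ := hpair B₃ hp₃ hb₃
  have hXne₁₂ := sdiff_ne_of_mem_pairPre hp₁ hp₂ h₁₂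
  have hXne₁₃ := sdiff_ne_of_mem_pairPre hp₁ hp₃ h₁₃
  have hXne₂₃ := sdiff_ne_of_mem_pairPre hp₂ hp₃ h₂₃
  rw [hX₁, hX₂] at hXne₁₂
  rw [hX₁, hX₃] at hXne₁₃
  rw [hX₂, hX₃] at hXne₂₃
  have hw₁₂ : w₁ ≠ w₂ := fun h => hXne₁₂ (by rw [h])
  have hw₁₃ : w₁ ≠ w₃ := fun h => hXne₁₃ (by rw [h])
  have hw₂₃ : w₂ ≠ w₃ := fun h => hXne₂₃ (by rw [h])
  have hbS : b ∈ S := (Finset.mem_sdiff.1 hb₁).1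
  have hw₁S : w₁ ∈ S := (Finset.mem_sdiff.1 (by rw [hX₁]; exact Finset.mem_insert_of_mem (Finset.mem_singleton_self _))).1
  have hw₂S : w₂ ∈ S := (Finset.mem_sdiff.1 (by rw [hX₂]; exact Finset.mem_insert_of_mem (Finset.mem_singleton_self _))).1
  have hw₃S : w₃ ∈ S := (Finset.mem_sdiff.1 (by rw [hX₃]; exact Finset.mem_insert_of_mem (Finset.mem_singleton_self _))).1
  -- membership in the `Bᵢ` via the pair sets
  have hmemB : ∀ B ∈ pairPre M 4 G S, ∀ e ∈ S, e ∉ S \ B → e ∈ B := by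
    intro B _ e heS heX
    by_contra h
    exact heX (Finset.mem_sdiff.2 ⟨heS, h⟩)
  have hyb : y ≠ b := by
    rintro rfl
    exact (Finset.mem_sdiff.1 hb₁).2 hy₁
  have hyw₁ : y ≠ w₁ := by
    rintro rfl
    exact (Finset.mem_sdiff.1 (by rw [hX₁]; exact Finset.mem_insert_of_mem (Finset.mem_singleton_self _))).2 hy₁
  have hyw₂ : y ≠ w₂ := by
    rintro rfl
    exact (Finset.mem_sdiff.1 (by rw [hX₂]; exact Finset.mem_insert_of_mem (Finset.mem_singleton_self _))).2 hy₂
  have hyw₃ : y ≠ w₃ := by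
    rintro rfl
    exact (Finset.mem_sdiff.1 (by rw [hX₃]; exact Finset.mem_insert_of_mem (Finset.mem_singleton_self _))).2 hy₃
  -- the set `R = S ∖ {b, w₁, w₂, w₃}`
  set R : Finset α := S \ {b, w₁, w₂, w₃} with hRdef
  have hRS : R ⊆ S := Finset.sdiff_subset
  have hRcard : 3 ≤ R.card := by
    have h1 := Finset.card_sdiff_add_card_inter S ({b, w₁, w₂, w₃} : Finset α)
    rw [← hRdef] at h1
    have h2 : (S ∩ {b, w₁, w₂, w₃}).card ≤ 4 := by
      calc (S ∩ {b, w₁, w₂, w₃}).card ≤ ({b, w₁, w₂, w₃} : Finset α).card := Finset.card_le_card Finset.inter_subset_right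
        _ ≤ 4 := Finset.card_le_four
    omega
  have hyR : y ∈ R := by
    rw [hRdef, Finset.mem_sdiff]
    refine ⟨subset_of_mem_pairPre hp₁ hy₁, ?_⟩
    simp only [Finset.mem_insert, Finset.mem_singleton, not_or]
    exact ⟨hyb, hyw₁, hyw₂, hyw₃⟩
  have hRsub₁ : R ⊆ B₁ := by
    intro e he
    have heS := hRS he
    apply hmemB B₁ hp₁ e heS
    rw [hX₁]
    intro h
    rw [hRdef, Finset.mem_sdiff] at he
    apply he.2
    simp only [Finset.mem_insert, Finset.mem_singleton] at h ⊢
    tauto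
  have hRsub₂ : R ⊆ B₂ := by
    intro e he
    have heS := hRS he
    apply hmemB B₂ hp₂ e heS
    rw [hX₂]
    intro h
    rw [hRdef, Finset.mem_sdiff] at he
    apply he.2
    simp only [Finset.mem_insert, Finset.mem_singleton] at h ⊢
    tauto
  have hRsub₃ : R ⊆ B₃ := by
    intro e he
    have heS := hRS he
    apply hmemB B₃ hp₃ e heS
    rw [hX₃]
    intro h
    rw [hRdef, Finset.mem_sdiff] at he
    apply he.2
    simp only [Finset.mem_insert, Finset.mem_singleton] at h ⊢
    tauto
  -- `R` has rank `3`
  have hR3 : 3 ≤ rkN M R := by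
    have hRe : R.erase y ⊆ G.erase y := Finset.erase_subset_erase _ (hRS.trans hSG)
    have hc : 2 ≤ (R.erase y).card := by
      rw [Finset.card_erase_of_mem hyR]
      omega
    have := three_le_rkN_insert_of_two_le_card hGg hyG hyc hsimple hRe hc
    rw [Finset.insert_erase hyR] at this
    exact this
  -- `cl Bᵢ ∩ cl Bⱼ ⊆ cl R`
  have hU₂ : B₂ ∈ Uq M (4 + 2) 4 := (mem_membersIn.1 (mem_pairPre.1 hp₂).1).1
  have hU₃ : B₃ ∈ Uq M (4 + 2) 4 := (mem_membersIn.1 (mem_pairPre.1 hp₃).1).1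
  have hclR : ∀ B B' : Finset α, B ∈ pairPre M 4 G S → B' ∈ pairPre M 4 G S → B ≠ B' → R ⊆ B → R ⊆ B' →
      clF M B ∩ clF M B' ⊆ clF M R := by
    intro B B' hB hB' hne hRB hRB'
    have hUB : B ∈ Uq M (4 + 2) 4 := (mem_membersIn.1 (mem_pairPre.1 hB).1).1
    have hUB' : B' ∈ Uq M (4 + 2) 4 := (mem_membersIn.1 (mem_pairPre.1 hB').1).1
    have hI : clF M B ∩ clF M B' ⊆ gr M :=
      Finset.inter_subset_left.trans ((mem_membersIn.1 (mem_pairPre.1 hB).1).2.trans hGg)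
    have hRI : R ⊆ clF M B ∩ clF M B' :=
      Finset.subset_inter ((hRB).trans (subset_clF hUB)) ((hRB').trans (subset_clF hUB'))
    have hle := rkN_inter_clF_le_three_of_pairPre hG hB hB' hne
    have hge := rkN_mono (M := M) hRI
    have heq : rkN M R = rkN M (clF M B ∩ clF M B') := by omega
    have := subset_closure_of_rkN_eq (M := M) hI hRI heq
    intro e he
    rw [mem_clF_iff]
    exact this (Finset.mem_coe.2 he)
  have hw₃R : w₃ ∈ clF M R := by
    apply hclR B₁ B₂ hp₁ hp₂ h₁₂ hRsub₁ hRsub₂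
    rw [Finset.mem_inter]
    refine ⟨subset_clF hU₁ ?_, subset_clF hU₂ ?_⟩
    · apply hmemB B₁ hp₁ w₃ hw₃S
      rw [hX₁]
      simp only [Finset.mem_insert, Finset.mem_singleton, not_or]
      exact ⟨hw₃b, hw₁₃.symm⟩
    · apply hmemB B₂ hp₂ w₃ hw₃S
      rw [hX₂]
      simp only [Finset.mem_insert, Finset.mem_singleton, not_or]
      exact ⟨hw₃b, hw₂₃.symm⟩
  have hw₂R : w₂ ∈ clF M R := by
    apply hclR B₁ B₃ hp₁ hp₃ h₁₃ hRsub₁ hRsub₃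
    rw [Finset.mem_inter]
    refine ⟨subset_clF hU₁ ?_, subset_clF hU₃ ?_⟩
    · apply hmemB B₁ hp₁ w₂ hw₂S
      rw [hX₁]
      simp only [Finset.mem_insert, Finset.mem_singleton, not_or]
      exact ⟨hw₂b, hw₁₂.symm⟩
    · apply hmemB B₃ hp₃ w₂ hw₂S
      rw [hX₃]
      simp only [Finset.mem_insert, Finset.mem_singleton, not_or]
      exact ⟨hw₂b, hw₂₃⟩
  -- `B₁ ⊆ cl R`, so `ρ(B₁) ≤ 3`
  have hB₁cl : B₁ ⊆ clF M R := by
    intro e he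
    by_cases heR : e ∈ R
    · exact subset_clF_of_subset_gr (hRS.trans (hSG.trans hGg)) heR
    · have heS : e ∈ S := subset_of_mem_pairPre hp₁ he
      have heX : e ∉ S \ B₁ := fun h => (Finset.mem_sdiff.1 h).2 he
      rw [hX₁] at heX
      rw [hRdef, Finset.mem_sdiff, not_and, not_not] at heR
      have := heR heS
      simp only [Finset.mem_insert, Finset.mem_singleton, not_or] at this heX
      rcases this with rfl | rfl | rfl | rfl
      · exact absurd rfl heX.1
      · exact absurd rfl heX.2
      · exact hw₂R
      · exact hw₃R
  have h1 := rkN_le_of_subset_clF' (M := M) hB₁cl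
  have h2 := rkN_eq_of_mem_Uq hU₁
  have h3 : rkN M R ≤ 3 := by
    have := rkN_mono (M := M) (Finset.subset_inter (hRsub₁.trans (subset_clF hU₁)) (hRsub₂.trans (subset_clF hU₂)))
    have := rkN_inter_clF_le_three_of_pairPre hG hp₁ hp₂ h₁₂
    omega
  omega

end PercRepro.Shadow
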